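import Literature.MathematicalPhysics.QuantumFieldTheory.Balaban1983to89.B9Cor36GCubeLocAtMemberRight
import Literature.MathematicalPhysics.QuantumFieldTheory.Balaban1983to89.B9Cor36GVKDivForm

/-!
# `Balaban1983to89.B9Cor36GCubeLocAtMemberClosed` — COROLLARY 3.6 p. 408 FOR THE BOND-SECTOR CUBE LETTER `G_□ = Δ_{a,□}⁻¹` AT THE LOCALISED FIELD `Ṽ_□ = e^{iηχ̃_□A}`, READ AT
# THE MEMBER: THE RIGHT ENTRY (3.42)₃ `G_□(Ṽ_□)·∇*_ν ≺ B₂·Lⁿη·e^{−ρd}` AND THE (3.42)-BLOCK `hE` OF THE CUT∕TRANSPORTED LETTER `O_□` WITH NO DISPLAYED OPERATOR INPUT LEFT —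
# p33's L-ASM `cor36_G_cube_rightEntry_at_locCfg` and F-F `eBlock_locLetterBY'` with their one displayed input `hDiv` FED BY NAME from p38's L-DIV
# `B9Cor36GVKDivForm.cor36_GK_mul_VK_at_locCfg` (sub-row G-B9-LETTERS, module M5.1b-G «Cor 3.5∕3.6 for the bond-sector cube letter G_□», programme RIGHT-ENTRY-V, the
# closing plug F-F′; lead ruling «G-F8 SPLIT» HOME/INBOX 2026-08-28T20:29:30Z; cell GAPS G-B9-02 entry n = 2 CLOSED at the member modulo the (3.35) datum only)

T. Bałaban, *Propagators for lattice gauge theories in a background field*, Commun. Math. Phys. **99** (1985) 389–434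
[`Balaban1985BackgroundPropagators`, "B9"]; [4] = Commun. Math. Phys. **96** (1984) 223–250 [`Balaban1984PropagatorsII`].

statement-level skeleton of published theorems with citation tags; proofs where landed; nothing here is a claim about the
Yang–Mills mass gap

THE PRINTED LOCUS (verbatim, held `paper:balaban1985-cmp99-background-propagators`, journal page = PDF page + 388; page owner r06).  Cor. 3.6 p. 408 l. 7–14: *«If a
configuration U satisfies (3.35) with O(1)Mα₀ ≦ a₁, and Ω′₀ ⊂ □ for a cube □ of the class described in this condition, then Theorems 3.1-3.3 hold for the operators
G′(U), (Q′(U)G′²(U)Q′\*(U))⁻¹, G(U) constructed for the sequence {Ω′_j}»*; p. 407 (3.86): *«This way we get all these inequalities for the operator G(U′U)»*; p. 397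
(3.42) (third entry `|(G′(U)∇\*_Uλ)(x)| ≦ B₀Lʲη e^{−δ₀d(y,y′)}|λ|`); (3.87)–(3.89) p. 409, p. 410 l. 14–15 (the cut letters of the expansion and their bounds).

WHY THIS FILE (cell `lit-balaban`; module M5.1b-G; GAPS G-B9-02 entry n = 2).  By the lead's «G-F8 SPLIT» the flat right entry `hR` of G-F6b's `eBlock_locLetterBY` was
proved in two layers: L-ASM (p33, `B9Cor36GCubeRightEntryAtLocCfg`, p667457) and the plug F-F (p33, `B9Cor36GCubeLocAtMemberRight`, p667683), both MODULO the displayed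
left composite `hDiv : GK·VK(Ṽ_□) ≺ κ_D·s·e^{−ρ_Dd}`; L-DIV (p38, `B9Cor36GVKDivForm`, p668635) proves `hDiv` in exactly that shape.  THIS FILE feeds the one into the
others (two `obtain … exact` plugs; no analysis): ★★★ `cor36_G_cube_rightEntry_at_locCfg'` — the right entry (3.42)₃ of `G_□(Ṽ_□)` uniformly in the member and the
cube with NO displayed operator input; ★★★ `eBlock_locLetterBY''` — G-F6b's `hE` per cube (unit + `EBlock` of the four (3.42) entries of `O_□`) with NO displayed
operator input: the remaining hypotheses are the (3.35) cube datum `(u, U, A; Q, C, ξ, Λ)`, the member thresholds and `s ≦ a₁` only.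

WHAT THIS FILE PROVES (THEOREMS; 0 `def … : Prop`, 0 sorry, 0 def).  ★★★ `cor36_G_cube_rightEntry_at_locCfg'`, ★★★ `eBlock_locLetterBY''`.

HONEST SCOPE.  Pure plug of three landed theorems (p667457, p667683, p668635).  NOT here: the Hölder ∕ `L²` entries (3.43)–(3.47); the defect majorants
`locDefectBY ∕ locDefectTBY` (programme DEFECT-R, p33) and the cover sums; uniform-`B₀` bookkeeping (RECORD item 3).  Count-neutral; no summit ∕ sub-problem statement is
proved; nothing continuum ∕ OS ∕ mass-gap ∕ Clay; NOT a node discharge; YM mass gap NOT proved by any of this (Track A conditional rung).  No `sorry`, no `axiom`, no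
`… : Prop` fact, no `instance`, no `notation`.  NEW file; nothing landed is modified.  Cell `lit-balaban`, seat `lit-balaban-p38` gen 45, 2026-08-28; `--supports
stmt-QuantumFields-19200`.  Net new unproved facts: 0.

RELATED IN THE TREE, NOT DUPLICATED (searched 2026-08-28: `rg "eBlock_locLetterBY''|rightEntry_at_locCfg'"` over `Literature/` = ∅): the three inputs above (USED BY
NAME); G-F6b `B9Cor36GCubeLocAtMember.eBlock_locLetterBY` (upstream of F-F).
-/

noncomputable section

namespace Literature.MathematicalPhysics.QuantumFieldTheory.Balaban1983to89.B9Cor36GCubeLocAtMemberClosed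

open NormedSpace Complex
open B6RandomWalk (HasMajorant)
open B9Thm34Ext (toB6)
open B9Eq352DivFormLetters (conj)
open B9Eq39Adjoint (covD fluct)
open B6KLevelCensusIndexV1 (KIdx kGeo)
open B6Cover236MultiLevelBlocks (cubes)
open B6GlobalChartV1 (PV boxEquiv)
open B9BackgroundsKLevelV1 (shiftsV1)
open B6Ineq2142KLevelV1 (β)
open B9GeoNormsKLevelV1 (geo9K)
open B9FromB6 (EBlock)
open B9Eq360DeltaPrimeAY (AfldY)
open B9CubeLettersBondOpsL0 (BlkCubeY deltaACubeY)
open B9CubeGeometryInputs (geoCK RM1)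
open B9CubeLettersInvReadings (kernelFamilyBInv)
open B9Cor36CubeCutoffs (SC NearC chiY locCfgY)
open B9Cor36GCubeLocLetter (locLetterBY)
open B9Cor35GCubeInputsAtOne (blkBK GVK)
open B9Cor36GCubeWindows (sRead)
open B9Cor36GCubeLocAtMemberRight (eBlock_locLetterBY')
open B9Cor36GCubeRightEntryAtLocCfg (cor36_G_cube_rightEntry_at_locCfg)
open B9Cor36GVKDivForm (cor36_GK_mul_VK_at_locCfg)
open B9CoReadingCoords (cdsBₗ)
open Node00 (SiteY BlkY IBondY FBondY CfgY GaugeY BondParY toKT gaugeY parSymY parBY)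

variable {d ℓ : ℕ} {hd : 1 ≤ d + 1} {hL : Odd (ℓ + 1) ∧ 1 < ℓ + 1} {b₀ b₁ : ℝ}
variable {𝔸 : Type} [NormedRing 𝔸] [NormedAlgebra ℂ 𝔸] [CompleteSpace 𝔸]
variable {ι : Type} [Fintype ι] (b : Module.Basis ι ℝ 𝔸)

/-- ★★★ **COROLLARY 3.6 FOR THE BOND-SECTOR CUBE LETTER, THE RIGHT ENTRY (3.42)₃ `G_□(Ṽ_□)∇*_ν ≺ B₂·Lⁿη·e^{−ρd}`, UNIFORMLY IN THE MEMBER AND THE COVER CUBE — NO DISPLAYED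
OPERATOR INPUT** (p33's L-ASM `cor36_G_cube_rightEntry_at_locCfg` with its `hDiv` fed from p38's L-DIV `cor36_GK_mul_VK_at_locCfg`): there are `ρ > 0`, `B₂ ≥ 0`,
thresholds `M₀, T₀, N₀` and `a₁ > 0` — functions of `d, L, b₀, b₁, M₂` — such that for every member above the thresholds, every cover cube, every `Rr, H`, every (3.35)
cube datum `(A, Q, C, ξ, Λ)` of Hermitian type with `sRead C Λ ≤ a₁`, and every direction `ν`: `GVK(Ṽ_□)·conj b(∇*_{1,ν}) ≺ B₂·(geoCK i □).len a·e^{−ρ·d(a,a′)}`.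
[cite: Balaban1985BackgroundPropagators, Cor. 3.6 p.408, Thm 3.4 p.400, (3.82)–(3.86) p.407, Thm 3.3 p.399, (3.42) p.397 (third entry), p.398 l.20–24, Cor. 3.5 p.407, p.409 l.1–5; Balaban1984PropagatorsII, Prop. 2.6 (2.136) p.247, Lemma 2.1 (2.61) p.234, (2.51)–(2.55) p.232] -/
theorem cor36_G_cube_rightEntry_at_locCfg' [NormOneClass 𝔸] [DecidableEq ι] (hℓ : 1 ≤ ℓ) (hb₀ : 0 < b₀) (hb₁ : b₀ ≤ b₁) (M₂ : ℝ) (hM₂ : 0 ≤ M₂)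
    (hrepr : ∀ (v : 𝔸) (j : ι), |b.repr v j| ≤ M₂ * ‖v‖) :
    ∃ ρ B₂ M₀ T₀ : ℝ, ∃ N₀ : ℕ, 0 < ρ ∧ 0 ≤ B₂ ∧ ∃ a₁ : ℝ, 0 < a₁ ∧
    ∀ (i : KIdx d ℓ hd hL b₀ b₁) (c : ↥(cubes (toKT i).D.toDomains)) (Rr : ℝ) (H : Prop),
      M₀ ≤ ((ℓ : ℝ) + 1) * (toKT i).Mh → N₀ + 1 ≤ (toKT i).R * ((ℓ + 1) * (toKT i).Mh) → T₀ ≤ RM1 i →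
    ∀ (A : AfldY 𝔸 i) (Q : Set (Site (PV d ℓ i.m i.K hd hL) 0)) (C ξ Λ : ℝ),
      0 ≤ C → 0 < ξ → 1 ≤ Λ → ξ ≤ 5 * (SC i c : ℝ) * (kGeo i).eta → LatticeNorms.scaleLen ((ℓ : ℝ) + 1) (kGeo i).eta (c.1.1 + 1) ≤ Λ * ξ →
      (∀ x : Site (PV d ℓ i.m i.K hd hL) 0, NearC i c (35 * SC i c / 8 + 1) (boxEquiv i.hN x).1 → x ∈ Q) →
      (∀ κ, ∀ x ∈ Q, ‖A κ x‖ ≤ C * ξ⁻¹) →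
      (∀ μ ν, ∀ x ∈ Q, ‖(((kGeo i).eta : ℂ)⁻¹) • covD (shiftsV1 (PV d ℓ i.m i.K hd hL)) (fun _ _ => (1 : 𝔸ˣ)) μ (A ν) x‖ ≤ C * (ξ ^ 2)⁻¹) →
      (∀ (t : ℝ) (κ : Fin (d + 1)) (x : Site (PV d ℓ i.m i.K hd hL) 0), ‖NormedSpace.exp ((I * (t : ℂ)) • A κ x)‖ ≤ 1) →
      sRead C Λ ≤ a₁ →
      ∀ ν : Fin (d + 1), HasMajorant (g := toB6 (geoCK i c) Rr H) (blkBK i c)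
        (GVK b i c (parSymY i) (parBY i) (locCfgY i c (kGeo i).eta A) * conj b (cdsBₗ i (fun _ _ => (1 : 𝔸ˣ)) ν))
        (fun a a' => B₂ * (geoCK i c).len a * Real.exp (-(ρ * (geoCK i c).dist a a'))) := by
  obtain ⟨ρD, κD, MD, TD, ND, hρD, hκD, aD, haD, hDiv⟩ := cor36_GK_mul_VK_at_locCfg b hℓ hb₀ hb₁ M₂ hM₂ hrepr
  exact cor36_G_cube_rightEntry_at_locCfg b hℓ hb₀ hb₁ M₂ hM₂ hrepr hρD hκD haD hDiv

/-- ★★★ **THE (3.42)-BLOCK `hE` OF THE BOND WRITER FOR THE CUBE LETTER `O_□` OF DESIGN (R), BOND SECTOR — G-F6b's `eBlock_locLetterBY` WITH NO DISPLAYED OPERATOR INPUT**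
(Corollary 3.6 at one cover cube, read at the member; the `hE` input of `B9Thm310DeltaAIsUnitOfExpansion.eBlock_kernelFamilyBInv_GAY_of_localInverseCubes''` per cube;
p33's F-F `eBlock_locLetterBY'` with its `hDiv` fed from p38's L-DIV `cor36_GK_mul_VK_at_locCfg`): there are a rate `δ > 0`, a constant `B₀ ≥ 0`, thresholds `M₀, N₀, T₀`
and `a₁ > 0` such that for every member above threshold, every cover cube □, every (3.35) cube datum `(u, U, A; Q, C, ξ, Λ)` of G-F6b's form with `sRead C Λ ≤ a₁`, `u` a
bi-contraction and every background family through `U`: `Δ_{a,□}(Ṽ_□)` is a unit AND `EBlock (kernelFamilyBInv i B cfg (fun _ => O_□) par) B₀ δ U₁` — the four (3.42)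
entries of `O_□ = locLetterBY i □ parSymY parBY u χ_□ Ṽ_□` over the member's geometry.
[cite: Balaban1985BackgroundPropagators, Cor. 3.6 p.408 l.1–14, (3.87)–(3.89) p.409, p.410 l.14–15, Thm 3.3 p.399 with Thm 3.1 (3.42) p.397, Thm 3.4 p.400, (3.86) p.407, (3.31) p.395, (3.100) p.413; Balaban1984PropagatorsII, (2.39)–(2.44) pp.229–230, (2.51)–(2.55) p.232] -/
theorem eBlock_locLetterBY'' [NormOneClass 𝔸] [DecidableEq ι] (hℓ : 1 ≤ ℓ) (hb₀ : 0 < b₀) (hb₁ : b₀ ≤ b₁) (M₂ : ℝ) (hM₂ : 0 ≤ M₂)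
    (hrepr : ∀ (v : 𝔸) (j : ι), |b.repr v j| ≤ M₂ * ‖v‖) :
    ∃ δ B₀ M₀ T₀ : ℝ, ∃ N₀ : ℕ, 0 < δ ∧ 0 ≤ B₀ ∧ ∃ a₁ : ℝ, 0 < a₁ ∧
    ∀ (i : KIdx d ℓ hd hL b₀ b₁) (c : ↥(cubes (toKT i).D.toDomains)),
      M₀ ≤ ((ℓ : ℝ) + 1) * (toKT i).Mh → N₀ + 1 ≤ (toKT i).R * ((ℓ + 1) * (toKT i).Mh) → T₀ ≤ RM1 i →
    ∀ (u : GaugeY 𝔸 i) (U : CfgY 𝔸 i) (A : AfldY 𝔸 i) (Q : Set (Site (PV d ℓ i.m i.K hd hL) 0)) (C ξ Λ : ℝ),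
      0 ≤ C → 0 < ξ → 1 ≤ Λ → ξ ≤ 5 * (SC i c : ℝ) * (kGeo i).eta → LatticeNorms.scaleLen ((ℓ : ℝ) + 1) (kGeo i).eta (c.1.1 + 1) ≤ Λ * ξ →
      (∀ x : Site (PV d ℓ i.m i.K hd hL) 0, NearC i c (35 * SC i c / 8 + 1) (boxEquiv i.hN x).1 → x ∈ Q) →
      (∀ (κ : Fin (d + 1)) (x : Site (PV d ℓ i.m i.K hd hL) 0), x ∈ Q → x.shift κ ∈ Q → gaugeY i u U κ x = fluct (kGeo i).eta A κ x) →
      (∀ κ, ∀ x ∈ Q, ‖A κ x‖ ≤ C * ξ⁻¹) →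
      (∀ μ ν, ∀ x ∈ Q, ‖(((kGeo i).eta : ℂ)⁻¹) • covD (shiftsV1 (PV d ℓ i.m i.K hd hL)) (fun _ _ => (1 : 𝔸ˣ)) μ (A ν) x‖ ≤ C * (ξ ^ 2)⁻¹) →
      (∀ (t : ℝ) (κ : Fin (d + 1)) (x : Site (PV d ℓ i.m i.K hd hL) 0), ‖NormedSpace.exp ((Complex.I * (t : ℂ)) • A κ x)‖ ≤ 1) →
      sRead C Λ ≤ a₁ →
      (∀ x, ‖((u x : 𝔸ˣ) : 𝔸)‖ ≤ 1 ∧ ‖(((u x)⁻¹ : 𝔸ˣ) : 𝔸)‖ ≤ 1) →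
    ∀ [Fintype (geo9K i).Site] (ιB : BlkY i → IBondY i) (_ : ∀ s, β i.hN i.D i.hk (ιB s) = s) (Rr : ℝ) (Hp : Prop)
      {B : B9.Backgrounds} (cfg : B.Cfg → CfgY 𝔸 i) (par : BondParY 𝔸 i) (U₁ : B.Cfg), cfg U₁ = U →
      IsUnit (deltaACubeY i c (parSymY i) (parBY i) (locCfgY i c (kGeo i).eta A)) ∧
      EBlock (kernelFamilyBInv i B cfg (fun _ => locLetterBY i c (parSymY i) (parBY i) u (chiY i c) (locCfgY i c (kGeo i).eta A)) par) B₀ δ U₁ := by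
  obtain ⟨ρD, κD, MD, TD, ND, hρD, hκD, aD, haD, hDiv⟩ := cor36_GK_mul_VK_at_locCfg b hℓ hb₀ hb₁ M₂ hM₂ hrepr
  exact eBlock_locLetterBY' b hℓ hb₀ hb₁ M₂ hM₂ hrepr hρD hκD haD hDiv

end Literature.MathematicalPhysics.QuantumFieldTheory.Balaban1983to89.B9Cor36GCubeLocAtMemberClosed

end
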